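import Summits.CriticalPhenomena.PercolationContinuityZ3.Theorems.PercAnnulusCrossingIICTargetLimit
import Summits.CriticalPhenomena.PercolationContinuityZ3.Theorems.PercAnnulusCrossingMetricToBoxRendering
import Literature.Probability.Percolation.TreeGraphBound
import HarnessLib

/-!
# Kesten's IIC with the PRINTED graph-metric conditioning `{0 ↔ S(0,n)}` on `ℤ^d` (lane RSW3, p1 gen 4)

builds on p205010 (kernel theorem, internal audit signed; external expert review pending)

Seat `prim-rsw3-p1` (gen 4).  Basu–Sapozhnikov state their Theorem 1.1 with the conditioning `{w ↔ S(w,n)}` on the graph-metric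
sphere `S(w,n) = {x : dist w x = n}` (on `ℤ^d`: the `ℓ¹`-sphere) and an UNRESTRICTED open connection; the lane's theorem (part XX′) uses
`{0 ↔ ∂ⁱⁿΛ(n) in Λ(n)}`.  By the conditioning-independence theorem (`PercAnnulusCrossingIICTarget{Existence,Limit}.lean`, their Remark 2.1 in
kernel form) the two agree: here the `ℓ¹`-sphere conditioning is shown to be admissible, so that under (A2)□ at any aspect the printed-form
ratio `P(E ∩ {0 ↔ S(0,n)}) / P(0 ↔ S(0,n))` converges, to the SAME limit as the box form.  Helper file; no definitions, no sorries.
* `openConn_sphere_iff_cond`, `real_inter_openConn_sphere_eq` — `{∃ s, dist 0 s = n ∧ 0 ↔ s} = {0 ↔ S₁(n) in B₁(n)}` on lattice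
  configurations (first arrival on the sphere), hence equal probabilities;
* `graphMetric_target_admissible` — for `1 ≤ n₀`, `d·n₀ < n`: `(B₁(n), S₁(n))` is admissible at scale `n₀`;
* **`iic_graphMetric_limit_of_setToSetQuasiMultAspectAt`** — `d ≥ 1`, `0 < p`, `θ(p) = 0`, (A2)□ at aspect `(s,L)`, `s ≥ 2`: the box IIC
  limit `ν(E)` exists and `P(E ∩ {0 ↔ S(0,n)}) / P(0 ↔ S(0,n)) → ν(E)`;
* **`iic_graphMetric_limit_criticalProbI_of_setToSetQuasiMultAspectAt`** — the same at `p_c(ℤ^d)`, `d ≥ 2`: the conclusion of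
  `Literature.Probability.Percolation.BasuSapozhnikov2017_thm_1_1_critical` for `G = ℤ^d`, `w = v = 0`, from (A2)□ at any aspect, with
  (A1) replaced by `θ(p_c) = 0`;
* **`iic_graphMetric_limit_criticalProbI_of_basuSapozhnikovQM`** — hypothesis AND conclusion in the printed vocabulary: (A2)_ρ ⇒ the printed
  IIC limit on `ℤ^d`.
References: D. Basu, A. Sapozhnikov, ECP 22 (2017) no. 26, Thm. 1.1 and Remark 2.1; H. Kesten, PTRF 73 (1986) Thm. (3).
-/

noncomputable section

namespace Summit.CriticalPhenomena.PercolationContinuityZ3.Theorems.Crossing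

open MeasureTheory Literature.Probability.Percolation Literature.Probability.LatticeModels
open Literature.Probability.Percolation.DCT16
open Summit.CriticalPhenomena.PercolationContinuityZ3.Theorems.SurfaceTension
open scoped Literature.Probability.Percolation
open Filter Topology

variable {d : ℕ}

/-! ## The printed conditioning event as a `COND(W,T)` -/

/-- **First arrival on the sphere** (lattice configurations): for `1 ≤ n` and `ω ⊆ E(ℤ^d)`,
`ω ∈ {∃ s, dist 0 s = n ∧ 0 ↔ s} ⟺ ω ∈ {∃ t ∈ S₁(n), 0 ↔ t in B₁(n)}` with `B₁(n) = {x ∈ Λ(n) : dist 0 x ≤ n}`, `S₁(n) = {x ∈ Λ(n) : dist 0 x = n}`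
(the graph distance of `ℤ^d` is the `ℓ¹` distance; an open path to the sphere, cut at its first vertex at distance `≥ n`, runs inside the
ball). [cite: BasuSapozhnikov2017ECP, Remark 2.1] -/
theorem openConn_sphere_iff_cond {n : ℕ} (hn : 1 ≤ n) {ω : BondConfig (Site d)} (hω : ω ⊆ (zdGraph d).edgeSet) :
    ω ∈ {ω : BondConfig (Site d) | ∃ s : Site d, (zdGraph d).dist 0 s = n ∧ ω ∈ openConn 0 s} ↔
      ω ∈ {ω : BondConfig (Site d) | ∃ t ∈ (box d n).filter (fun x => (zdGraph d).dist 0 x = n),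
        ω ∈ openConnIn (↑((box d n).filter (fun x => (zdGraph d).dist 0 x ≤ n)) : Set (Site d)) 0 t} := by
  classical
  constructor
  · rintro ⟨s, hs, hωs⟩
    have hP : PathIn (openGraph ω) Set.univ (0 : Site d) s := DCT16.pathIn_univ_of_reachable hωs
    set B : Set (Site d) := {x | (zdGraph d).dist 0 x < n} with hB
    have h0 : (0 : Site d) ∈ B := by
      show (zdGraph d).dist 0 0 < n
      rw [SimpleGraph.dist_self]; omega
    have hsB : s ∉ B := fun h => by
      have h' : (zdGraph d).dist 0 s < n := h
      omega
    obtain ⟨a, b, ha, hb, -, hab, hpre⟩ := hP.exit h0 hsB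
    have hab' : (zdGraph d).Adj a b := adj_of_openGraph_adj hω hab
    have ha' : (zdGraph d).dist 0 a < n := ha
    have hb' : ¬ (zdGraph d).dist 0 b < n := hb
    have hdb : (zdGraph d).dist 0 b = n := by
      have := (dist_zero_le_succ_of_adj hab').1
      omega
    have hsub : B ∩ Set.univ ⊆ (↑((box d n).filter (fun x => (zdGraph d).dist 0 x ≤ n)) : Set (Site d)) := by
      rintro z ⟨hz, -⟩
      have hz' : (zdGraph d).dist 0 z < n := hz
      rw [Finset.coe_filter]
      exact ⟨mem_box_of_dist_zero_le hz'.le, hz'.le⟩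
    have hbW : b ∈ (↑((box d n).filter (fun x => (zdGraph d).dist 0 x ≤ n)) : Set (Site d)) := by
      rw [Finset.coe_filter]; exact ⟨mem_box_of_dist_zero_le hdb.le, hdb.le⟩
    exact ⟨b, Finset.mem_filter.2 ⟨mem_box_of_dist_zero_le hdb.le, hdb⟩,
      mem_openConnIn_of_pathIn ((hpre.mono hsub).trans (PathIn.of_adj (hsub hpre.right_mem) hbW hab))⟩
  · rintro ⟨t, ht, hωt⟩
    exact ⟨t, (Finset.mem_filter.1 ht).2, openConnIn_subset_openConn _ 0 t hωt⟩

/-- The two conditional-probability numerators/denominators agree (the events agree on lattice configurations). [folklore] -/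
theorem real_inter_openConn_sphere_eq (p : unitInterval) {n : ℕ} (hn : 1 ≤ n) (E : Set (BondConfig (Site d))) :
    (bondPercolation (zdGraph d) p).real (E ∩ {ω : BondConfig (Site d) | ∃ s : Site d, (zdGraph d).dist 0 s = n ∧ ω ∈ openConn 0 s}) =
      (bondPercolation (zdGraph d) p).real (E ∩ {ω : BondConfig (Site d) | ∃ t ∈ (box d n).filter (fun x => (zdGraph d).dist 0 x = n),
        ω ∈ openConnIn (↑((box d n).filter (fun x => (zdGraph d).dist 0 x ≤ n)) : Set (Site d)) 0 t}) :=
  real_congr_of_forall_subset_edgeSet (zdGraph d) p fun ω hω => by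
    simp only [Set.mem_inter_iff]
    exact and_congr_right fun _ => openConn_sphere_iff_cond hn hω

/-! ## The `ℓ¹` ball is an admissible conditioning region -/

/-- **Admissibility of the graph-metric sphere**: for `1 ≤ n₀` and `d·n₀ < n`, `Λ(n₀) ⊆ B₁(n)`, `S₁(n) ⊆ B₁(n) ∖ Λ(n₀−1)`, and every
site of `∂ⁱⁿΛ(n₀)` is joined to `S₁(n)` by a lattice walk inside `B₁(n) ∖ Λ(n₀−1)` (a straight ray along the exit coordinate, cut at its
first vertex at graph distance `n`). [folklore] -/
theorem graphMetric_target_admissible {n₀ n : ℕ} (hn₀ : 1 ≤ n₀) (hn : d * n₀ < n) :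
    box d n₀ ⊆ (box d n).filter (fun x => (zdGraph d).dist 0 x ≤ n) ∧
      (box d n).filter (fun x => (zdGraph d).dist 0 x = n) ⊆ (box d n).filter (fun x => (zdGraph d).dist 0 x ≤ n) ∧
      (∀ t ∈ (box d n).filter (fun x => (zdGraph d).dist 0 x = n), t ∉ box d (n₀ - 1)) ∧
      (∀ x ∈ innerBoundary (zdGraph d) (box d n₀), ∃ t ∈ (box d n).filter (fun x => (zdGraph d).dist 0 x = n),
        ∃ q : (zdGraph d).Walk x t, ∀ z ∈ q.support,
          z ∈ (↑((box d n).filter (fun x => (zdGraph d).dist 0 x ≤ n)) : Set (Site d)) \ ↑(box d (n₀ - 1))) := by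
  classical
  refine ⟨fun x hx => ?_, fun t ht => ?_, fun t ht h => ?_, fun x hx => ?_⟩
  · have h1 := dist_zero_le_of_mem_box hx
    exact Finset.mem_filter.2 ⟨mem_box_of_dist_zero_le (by omega), by omega⟩
  · exact Finset.mem_filter.2 ⟨(Finset.mem_filter.1 ht).1, (Finset.mem_filter.1 ht).2.le⟩
  · have h1 := dist_zero_le_of_mem_box h
    have h2 := (Finset.mem_filter.1 ht).2
    have h3 : d * (n₀ - 1) ≤ d * n₀ := Nat.mul_le_mul_left d (Nat.sub_le n₀ 1)
    omega
  · -- the ray along the exit coordinate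
    have hxn : x ∈ box d n₀ := (Finset.mem_filter.1 hx).1
    have hxn1 : x ∉ box d (n₀ - 1) := notMem_box_of_mem_innerBoundary_box (by omega) hx
    have hxd : (zdGraph d).dist 0 x < n := lt_of_le_of_lt (dist_zero_le_of_mem_box hxn) hn
    rw [mem_box] at hxn hxn1
    push Not at hxn1
    obtain ⟨i, hi⟩ := hxn1
    have hxi := hxn i
    have hcast : ((n₀ - 1 : ℕ) : ℤ) = (n₀ : ℤ) - 1 := by push_cast [Nat.cast_sub (by omega : 1 ≤ n₀)]; ring
    obtain ⟨σ, hσ, hxiσ⟩ : ∃ σ : ℤ, (σ = 1 ∨ σ = -1) ∧ x i = σ * n₀ := by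
      by_cases h : -((n₀ - 1 : ℕ) : ℤ) ≤ x i
      · have := hi h; rw [hcast] at this
        exact ⟨1, Or.inl rfl, by omega⟩
      · rw [hcast] at h
        exact ⟨-1, Or.inr rfl, by omega⟩
    obtain ⟨R, hR⟩ := exists_ray_walk i hσ x (n + 1)
    have hray : ∀ j : ℕ, x + Pi.single i (σ * j) ∉ box d (n₀ - 1) := by
      intro j h
      rw [mem_box] at h
      have := h i
      rw [ray_apply, if_pos rfl, hxiσ, hcast] at this
      rcases hσ with rfl | rfl <;> omega
    have hend : x + Pi.single i (σ * (n + 1 : ℕ)) ∉ box d n := by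
      rw [mem_box]
      intro h
      have := h i
      rw [ray_apply, if_pos rfl, hxiσ] at this
      push_cast at this
      rcases hσ with rfl | rfl <;> omega
    -- cut the ray at its first vertex at graph distance `≥ n`
    set B : Set (Site d) := {y | (zdGraph d).dist 0 y < n} with hB
    have hxB : x ∈ B := hxd
    have heB : x + Pi.single i (σ * (n + 1 : ℕ)) ∉ B := fun h => by
      have h' : (zdGraph d).dist 0 (x + Pi.single i (σ * (n + 1 : ℕ))) < n := h
      have := lt_dist_zero_of_notMem_box hend
      omega
    obtain ⟨a, b, q, r, hab, ha, hb, hqB, hqR, hrR, -⟩ := exists_cut_walk_edge B R hxB heB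
    have ha' : (zdGraph d).dist 0 a < n := ha
    have hb' : ¬ (zdGraph d).dist 0 b < n := hb
    have hdb : (zdGraph d).dist 0 b = n := by
      have := (dist_zero_le_succ_of_adj hab).1
      omega
    have hbR : b ∈ R.support := hrR b r.start_mem_support
    refine ⟨b, Finset.mem_filter.2 ⟨mem_box_of_dist_zero_le hdb.le, hdb⟩, q.concat hab, fun z hz => ?_⟩
    rw [SimpleGraph.Walk.support_concat, List.mem_append, List.mem_singleton] at hz
    rw [Finset.coe_filter]
    rcases hz with hz | rfl
    · have hz' : (zdGraph d).dist 0 z < n := hqB z hz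
      obtain ⟨j, -, rfl⟩ := hR z (hqR z hz)
      exact ⟨⟨mem_box_of_dist_zero_le hz'.le, hz'.le⟩, fun h => hray j (Finset.mem_coe.1 h)⟩
    · obtain ⟨j, -, hj⟩ := hR z hbR
      refine ⟨⟨mem_box_of_dist_zero_le hdb.le, hdb.le⟩, fun h => hray j ?_⟩
      rw [← hj]; exact Finset.mem_coe.1 h

/-! ## The printed-form IIC limit -/

/-- **Kesten's IIC with the graph-metric conditioning of the printed theorem, under (A2)□ at aspect `(s, L)`** (`d ≥ 1`, `0 < p`,
`θ(p) = 0`, `s ≥ 2`, `ϰ > 0`): for every cylinder event `E` the box IIC limit `ν(E)` exists and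
`P_p(E ∩ {0 ↔ S(0,n)}) / P_p(0 ↔ S(0,n)) → ν(E)` (`S(0,n)` the graph-metric sphere, unrestricted connection) — the same IIC.
[cite: BasuSapozhnikov2017ECP, Thm. 1.1 and Remark 2.1] [cite: Kesten1986, Thm. (3)] -/
theorem iic_graphMetric_limit_of_setToSetQuasiMultAspectAt (hd : 1 ≤ d) (p : unitInterval) (hp : 0 < (p : ℝ))
    (hθ : theta (zdGraph d) 0 p = 0) {s L : ℕ} (hs : 2 ≤ s) {ϰ : ℝ} (hϰ : 0 < ϰ) (hA2 : SetToSetQuasiMultAspectAt d p s L ϰ)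
    (F : Finset (Sym2 (Site d))) (E : Set (BondConfig (Site d))) (hEm : MeasurableSet E) (hEF : DeterminedBy E ↑F) :
    ∃ ν : ℝ, Tendsto (fun n : ℕ => (bondPercolation (zdGraph d) p).real (E ∩ siteToBoundary d n) / oneArmProb d p n) atTop (𝓝 ν) ∧
      Tendsto (fun n : ℕ => (bondPercolation (zdGraph d) p).real (E ∩ {ω | ∃ x : Site d, (zdGraph d).dist 0 x = n ∧ ω ∈ openConn 0 x}) /
          (bondPercolation (zdGraph d) p).real {ω | ∃ x : Site d, (zdGraph d).dist 0 x = n ∧ ω ∈ openConn 0 x}) atTop (𝓝 ν) := by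
  obtain ⟨ν, hν, hunif⟩ := iic_limit_condIndep_of_setToSetQuasiMultAspectAt hd p hp hθ hs hϰ hA2 F E hEm hEF
  refine ⟨ν, hν, Metric.tendsto_atTop.2 fun ε hε => ?_⟩
  obtain ⟨n₀, hn₀, h⟩ := hunif (ε / 2) (half_pos hε)
  refine ⟨d * n₀ + 1, fun n hn => ?_⟩
  have hn1 : 1 ≤ n := by omega
  obtain ⟨h1, h2, h3, h4⟩ := graphMetric_target_admissible (d := d) hn₀ (by omega : d * n₀ < n)
  have key := h _ _ h1 h2 h3 h4
  have e1 := real_inter_openConn_sphere_eq p hn1 E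
  have e2 := real_inter_openConn_sphere_eq p hn1 (Set.univ : Set (BondConfig (Site d)))
  rw [Set.univ_inter, Set.univ_inter] at e2
  rw [Real.dist_eq]
  change |(bondPercolation (zdGraph d) p).real (E ∩ {ω | ∃ x : Site d, (zdGraph d).dist 0 x = n ∧ ω ∈ openConn 0 x}) /
      (bondPercolation (zdGraph d) p).real {ω | ∃ x : Site d, (zdGraph d).dist 0 x = n ∧ ω ∈ openConn 0 x} - ν| < ε
  rw [e1, e2]
  linarith

/-- **The printed-form IIC at `p_c(ℤ^d)` under (A2)□ at aspect `(s, L)`** (`d ≥ 2`, `s ≥ 2`; `θ(p_c) = 0` by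
`CSH.percolationContinuity_allDimensions`): the conclusion of Basu–Sapozhnikov's Theorem 1.1 for `G = ℤ^d` at `w = 0` — the limit
`lim_n P_{p_c}(E | 0 ↔ S(0,n))` with their graph-metric spheres exists — derived in kernel form from (A2)□ alone ((A1) replaced by
`θ(p_c) = 0`), and it coincides with the box IIC of part XX′. [cite: BasuSapozhnikov2017ECP, Thm. 1.1 and Remark 2.1] -/
theorem iic_graphMetric_limit_criticalProbI_of_setToSetQuasiMultAspectAt (hd : 2 ≤ d) {s L : ℕ} (hs : 2 ≤ s) {ϰ : ℝ} (hϰ : 0 < ϰ)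
    (hA2 : SetToSetQuasiMultAspectAt d (criticalProbI d) s L ϰ)
    (F : Finset (Sym2 (Site d))) (E : Set (BondConfig (Site d))) (hEm : MeasurableSet E) (hEF : DeterminedBy E ↑F) :
    ∃ ν : ℝ, Tendsto (fun n : ℕ => (bondPercolation (zdGraph d) (criticalProbI d)).real (E ∩ siteToBoundary d n) /
        oneArmProb d (criticalProbI d) n) atTop (𝓝 ν) ∧
      Tendsto (fun n : ℕ => (bondPercolation (zdGraph d) (criticalProbI d)).real
            (E ∩ {ω | ∃ x : Site d, (zdGraph d).dist 0 x = n ∧ ω ∈ openConn 0 x}) /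
          (bondPercolation (zdGraph d) (criticalProbI d)).real {ω | ∃ x : Site d, (zdGraph d).dist 0 x = n ∧ ω ∈ openConn 0 x})
        atTop (𝓝 ν) := by
  have hpc : 0 < ((criticalProbI d : unitInterval) : ℝ) := by
    have h := Literature.Barriers.CriticalPhenomena.criticalProbI_pos' (d := d) (by omega)
    exact_mod_cast h
  exact iic_graphMetric_limit_of_setToSetQuasiMultAspectAt (by omega) (criticalProbI d) hpc (CSH.percolationContinuity_allDimensions d hd)
    hs hϰ hA2 F E hEm hEF


/-- **Basu–Sapozhnikov's Theorem 1.1 for `ℤ^d` at criticality, hypothesis AND conclusion in the printed vocabulary** (`d ≥ 2`, `ϰ > 0`):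
the printed graph-metric (A2)_ρ at `p_c` (`BasuSapozhnikovQM (zdGraph d) 0 p_c ϰ`) implies that for every cylinder event `E` the limit
`lim_n P_{p_c}(E ∩ {0 ↔ S(0,n)}) / P_{p_c}(0 ↔ S(0,n))` exists (and equals the box IIC limit) — (A1) replaced by `θ(p_c) = 0`; kernel form,
nothing printed assumed ((A2)_ρ ⇒ (A2)□ at aspect `(4d, 16d²)` is p222697).
[cite: BasuSapozhnikov2017ECP, Thm. 1.1 and Remark 2.1] [cite: Kesten1986, Thm. (3)] -/
theorem iic_graphMetric_limit_criticalProbI_of_basuSapozhnikovQM (hd : 2 ≤ d) {ϰ : ℝ} (hϰ : 0 < ϰ)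
    (hBS : BasuSapozhnikovQM (zdGraph d) (0 : Site d) (criticalProbI d) ϰ)
    (F : Finset (Sym2 (Site d))) (E : Set (BondConfig (Site d))) (hEm : MeasurableSet E) (hEF : DeterminedBy E ↑F) :
    ∃ ν : ℝ, Tendsto (fun n : ℕ => (bondPercolation (zdGraph d) (criticalProbI d)).real (E ∩ siteToBoundary d n) /
        oneArmProb d (criticalProbI d) n) atTop (𝓝 ν) ∧
      Tendsto (fun n : ℕ => (bondPercolation (zdGraph d) (criticalProbI d)).real
            (E ∩ {ω | ∃ x : Site d, (zdGraph d).dist 0 x = n ∧ ω ∈ openConn 0 x}) /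
          (bondPercolation (zdGraph d) (criticalProbI d)).real {ω | ∃ x : Site d, (zdGraph d).dist 0 x = n ∧ ω ∈ openConn 0 x})
        atTop (𝓝 ν) :=
  iic_graphMetric_limit_criticalProbI_of_setToSetQuasiMultAspectAt hd (s := 4 * d) (L := 4 * d * (4 * d)) (by omega) (by positivity)
    (setToSetQuasiMultAspectAt_of_basuSapozhnikovQM hd hϰ.le hBS) F E hEm hEF

end Summit.CriticalPhenomena.PercolationContinuityZ3.Theorems.Crossing

end
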